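import Summits.CriticalPhenomena.PercolationContinuityZ3.Theorems.PercExchangeRateTransportCriticalCurveRegular

/-!
# F3 WITNESS for the rung `IsoLeftMin` — line `iso_left_min` (fwd-rung G1 gen 7 over `CriticalCurveRegular`;
# crux K⁺ `SupercritExchangeUniformity`, stmt-CriticalPhenomena-16061; route `PercExchangeRateTransport`)

The rung is the `T = {p₃}` member (`p₃ = p_c(ℤ³)`) of the graded family `CurveLeftMinWithin T` := (floor
`CriticalCurveRegular`) ∧ (∀ t₀ ∈ T ∩ (0,1), ∃ lo ∈ (0,t₀), ∀ s ∈ [lo,t₀], J(t₀) ≤ J(s)), `J(t) = θ(p_c(t),t)`.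
Specialising the parameter to `T := ∅` gives a statement that is literally the proved floor: the `example` below is
`by simpa using <floor>` from the seed `Cruxes.CriticalCurveRegular.Locmod.CriticalCurveRegular_proof` (item 16065),
and `curveLeftMinWithin_empty_iff` records `CurveLeftMinWithin ∅ ↔ CriticalCurveRegular`.
witness_regime: the label-coupled anisotropic bond family on `ℤ²×ℤ`, the isotropic level `t₀ = p₃`; nothing about the
VALUES of `θ` on the critical curve near the isotropic point is known (at `t = p₃` the value `J(p₃) = θ_{ℤ³}(p_c)` is
the sub-problem statement itself), and the order clause at `T = {p₃}` is not a consequence of the floor (forward kernel: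
`floor_implies_rung` must not close).  Self-contained copy of the family (verbatim the `def`s of `Lines/iso_left_min.lean`,
separate namespace).
-/

namespace Summit.CriticalPhenomena.PercolationContinuityZ3.Cruxes.SupercritExchangeUniformity.LeftMin.Special

open Summit.CriticalPhenomena.PercolationContinuityZ3.Theses.PercExchangeRateTransport

/-- Verbatim copy of `LeftMin.CurveLeftMinWithin` (self-contained witness file). -/
def CurveLeftMinWithin (T : Set ℝ) : Prop :=
  let μ := Literature.Probability.Percolation.labelMeasure (Literature.Probability.LatticeModels.Site 3); let vert : Sym2 (Literature.Probability.LatticeModels.Site 3) → Prop := fun e => ∃ x : Literature.Probability.LatticeModels.Site 3, e = s(x, x + Pi.single (2 : Fin 3) 1); let cfg : ℝ → ℝ → (Sym2 (Literature.Probability.LatticeModels.Site 3) → ℝ) → Set (Sym2 (Literature.Probability.LatticeModels.Site 3)) := fun p t U => {e | e ∈ (Literature.Probability.LatticeModels.zdGraph 3).edgeSet ∧ ((vert e ∧ U e ≤ t) ∨ (¬ vert e ∧ U e ≤ p))}; let θ : ℝ → ℝ → ℝ := fun p t => μ.real {U | cfg p t U ∈ Literature.Probability.Percolation.percolatesAt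 (0 : Literature.Probability.LatticeModels.Site 3)}; let pc : ℝ → ℝ := fun t => sInf ({p : ℝ | 0 ≤ p ∧ p ≤ 1 ∧ 0 < θ p t} ∪ {1}); (ContinuousOn pc (Set.Ioo 0 1) ∧ ∀ t ∈ Set.Ioo (0 : ℝ) 1, 0 < pc t ∧ pc t < 1) ∧ ∀ t₀ ∈ T, t₀ ∈ Set.Ioo (0 : ℝ) 1 → ∃ lo : ℝ, 0 < lo ∧ lo < t₀ ∧ ∀ s ∈ Set.Icc lo t₀, θ (pc t₀) t₀ ≤ θ (pc s) s

/-- Verbatim copy of `LeftMin.IsoLeftMin`: the rung, `T = {p₃}`. -/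
def IsoLeftMin : Prop := CurveLeftMinWithin {Literature.Probability.Percolation.criticalProb (Literature.Probability.LatticeModels.zdGraph 3) (0 : Literature.Probability.LatticeModels.Site 3)}

/-- **F3 witness: the floor is the `T = ∅` instance of the family**, by `simpa` from the seed. -/
example : CurveLeftMinWithin ∅ := by
  simpa [CurveLeftMinWithin, CriticalCurveRegular] using
    Summit.CriticalPhenomena.PercolationContinuityZ3.Cruxes.CriticalCurveRegular.Locmod.CriticalCurveRegular_proof

/-- The same as a named theorem with a two-line term. -/
theorem curveLeftMinWithin_floor : CurveLeftMinWithin ∅ := by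
  unfold CurveLeftMinWithin
  exact ⟨Summit.CriticalPhenomena.PercolationContinuityZ3.Cruxes.CriticalCurveRegular.Locmod.CriticalCurveRegular_proof,
    fun t ht _ => (Set.notMem_empty t ht).elim⟩

/-- … and the floor is literally the `T = ∅` member (both directions). -/
theorem curveLeftMinWithin_empty_iff : CurveLeftMinWithin ∅ ↔ CriticalCurveRegular := by
  unfold CurveLeftMinWithin CriticalCurveRegular
  exact ⟨fun h => h.1, fun h => ⟨h, fun t ht _ => (Set.notMem_empty t ht).elim⟩⟩

/-- The family is antitone in `T`; in particular the rung hands back the floor. -/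
theorem curveLeftMinWithin_mono {T T' : Set ℝ} (h : T ⊆ T') : CurveLeftMinWithin T' → CurveLeftMinWithin T := by
  unfold CurveLeftMinWithin
  intro h'
  exact ⟨h'.1, fun t ht => h'.2 t (h ht)⟩

theorem floor_of_rung : IsoLeftMin → CriticalCurveRegular := fun h =>
  curveLeftMinWithin_empty_iff.1 (curveLeftMinWithin_mono (Set.empty_subset _) h)

end Summit.CriticalPhenomena.PercolationContinuityZ3.Cruxes.SupercritExchangeUniformity.LeftMin.Special
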